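import Summits.KontsevichZagierPeriods.KontsevichZagierPeriods.Theses.FurushoPentagon
import Summits.KontsevichZagierPeriods.KontsevichZagierPeriods.Theorems.FurushoPentagonReducedPeriodRingLinStokesSymDefs
import Summits.KontsevichZagierPeriods.KontsevichZagierPeriods.Theorems.FurushoPentagonReducedPeriodRingHyperoctahedralFactorisation
import Summits.KontsevichZagierPeriods.KontsevichZagierPeriods.Theorems.FurushoPentagonLinStokesSymCovReduction
import Summits.KontsevichZagierPeriods.KontsevichZagierPeriods.Theorems.FurushoPentagonReducedPeriodRingSubdivGeneration
import Literature.NumberTheory.Transcendental.KZCubicalCalculus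
import Literature.NumberTheory.Transcendental.KZProductIdeal

/-!
# `ReducedPeriodRing`, line `lin-stokes-sym`: cubical changes of variables from Lin + StokesLast + Sym

Crux `FurushoPentagon.ReducedPeriodRing` (stmt-KontsevichZagierPeriods-3929), line `lin-stokes-sym`,
stub `stub_covGeneration`: every change-of-variables generator `[r] − [r']` of the cubical
Kontsevich–Zagier calculus (`KZ.cubicalCovGens`: tame cubes `r, r'` on `[0,1]ⁿ`, a map `Φ` with
coordinates analytic near the cube and `ℚ`-semialgebraic on it, injective on the cube, onto the
cube, with `r = r'(Φ)·|det Φ'|` on the cube) lies in Ayoub's relation module with symmetries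
`linStokesSymIdeal = closure (Lin ∪ StokesLast ∪ Sym)` (`…ReducedPeriodRingLinStokesSymDefs`).

The proof is the reduction `…LinStokesSymCovReduction` (hyperoctahedral normalisation,
orientation via soundness, and the face-preserving homotopy formula of `…LinStokesSymCovFace`,
`…CovClosed`, `…CovHomotopy`, `…CovDet`) applied to the face structure of analytic injective
self-maps of the cube onto the cube (`stub_hyperoctahedralFactorisation`,
`…ReducedPeriodRingHyperoctahedralFactorisation`).

References: M. Kontsevich, D. Zagier, *Periods* (2001), §1.2 rules (1)–(3); J. Ayoub, *Periods
and the conjectures of Grothendieck and Kontsevich–Zagier*, EMS Newsl. 91 (2014), Def. 10.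
-/

noncomputable section

namespace Summit.KontsevichZagierPeriods.FurushoPentagon.ReducedPeriodRing.LinStokesSym

open Set MeasureTheory
open Literature.NumberTheory.Transcendental
open Literature.NumberTheory.Transcendental.KZ

/-- **Stub `stub_covGeneration`** (crux stmt-KontsevichZagierPeriods-3929, line `lin-stokes-sym`):
every change-of-variables generator of the cubical calculus (`KZ.cubicalCovGens`) lies in
Ayoub's relation module with symmetries `linStokesSymIdeal = closure (Lin ∪ StokesLast ∪ Sym)`:
the reduction `stub_covGeneration_reduction` (hyperoctahedral normalisation, orientation via
soundness, face-preserving homotopy formula) applied to the face structure of analytic injective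
self-maps of the cube (`stub_hyperoctahedralFactorisation`).
[Kontsevich–Zagier 2001, §1.2 rules (1)–(3); Ayoub 2014, Def. 10] -/
theorem stub_covGeneration : KZ.cubicalCovGens ⊆ (linStokesSymIdeal : Set FormalRep) :=
  stub_covGeneration_reduction stub_hyperoctahedralFactorisation

/-- **Green generation** (line `lin-stokes-sym`, skeleton node): Lin + StokesLast + Sym generate the
tree's whole four-family cubical move span, `KZ.cubicalSpan ≤ linStokesSymIdeal` — linearity and
last-coordinate Newton–Leibniz are generators, dyadic subdivision is `stub_subdivGeneration`
(`…ReducedPeriodRingSubdivGeneration`), change of variables is `stub_covGeneration`. This is the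
bridge that makes the line's pinned target literally Ayoub's presentation (Stokes in every
coordinate) and the constructive answer to the slice-functional death of line `ayoub-stokes-cartier`
(`Theorems/ReducedPeriodRing/Negative/KernelControlModPi.lean`: the refuting subdivision witness
lies in this ideal). [Ayoub 2014, Def. 10; Kontsevich–Zagier 2001, §1.2] -/
theorem greenGeneration : KZ.cubicalSpan ≤ linStokesSymIdeal := by
  refine (AddSubgroup.closure_le _).mpr ?_
  rintro x (((hx | hx) | hx) | hx)
  · exact cubicalLinGens_subset_linStokesSymIdeal hx
  · exact cubicalStokesGens_subset_linStokesSymIdeal hx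
  · exact stub_covGeneration hx
  · exact stub_subdivGeneration hx

/-- The dead line's kernel-control target and this line's pinned ideal, compared: the four-family
cubical span lies in `linStokesSymIdeal`, which lies in `KZ.relations`. [folklore] -/
theorem cubicalSpan_le_linStokesSymIdeal_le_relations :
    KZ.cubicalSpan ≤ linStokesSymIdeal ∧ linStokesSymIdeal ≤ relations :=
  ⟨greenGeneration, linStokesSymIdeal_le_relations⟩

end Summit.KontsevichZagierPeriods.FurushoPentagon.ReducedPeriodRing.LinStokesSym
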